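import Mathlib
import Literature.Probability.Process.StableLikeJumpChain
import HarnessLib

/-!
# Green-function asymptotics of symmetric heavy-tailed random walks on `ℤ³`
# (Williamson 1968; Berger 2019; the potential kernel of the limiting stable law)

Topic `Probability/Process`. A symmetric random walk `S_n` on `ℤ³` whose step law `q` has an
asymptotically homogeneous heavy tail,

  `q(x) · |x|₂^{3+α} - φ(x/|x|₂) → 0` as `|x| → ∞`,  `1 < α < 2`,

with a continuous angular profile `φ ≥ 0`, `φ ≢ 0` on the unit sphere, lies in the domain of NORMAL
attraction (norming `n^{1/α}`, no centring: `q` is symmetric) of the genuinely three-dimensional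
symmetric `α`-stable law whose Lévy measure is `ν(dz) = φ(z/|z|) |z|^{-3-α} dz`; it is aperiodic and
genuinely three-dimensional in Spitzer's sense as soon as `φ > 0` somewhere (then `q > 0` at all far
sites of an open cone, whose differences generate `ℤ³`), and transient (`α < 3`).  The NAMED FACT
`stableWalkGreenAsymptotics` below records the strong renewal theorem for its Green function
`G_q(x) = ∑_{n ≥ 0} P(S_n = x)` (written with the tree's Chapman–Kolmogorov recursion
`Literature.Probability.Process.jumpChainProb` for the translation-invariant conductances
`C y z = q (z - y)`, whose rows sum to `1`):

  `G_q(x) · |x|₂^{3-α} - K(x/|x|₂) → 0` as `|x| → ∞`,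

where `K`, continuous and positive on `ℝ³ ∖ 0` and homogeneous of degree `α - 3`, is the potential
(zero-resolvent) density `K(x) = ∫₀^∞ p_t(x) dt` of that stable law, characterised here WITHOUT Fourier
transforms or densities by the potential equation `∫ K(x - y) (L_φ f)(y) dy = -f(x)` for all `C²`
compactly supported `f`, `L_φ f(y) = ½ ∫ (f(y+z) + f(y-z) - 2 f(y)) |z|^{-3-α} φ(z/|z|) dz` being the
generator of the (symmetric) stable semigroup on such `f`.

Printed sources, clause by clause.
* Transience and the asymptotic `G_q ∼ K` uniformly in the direction: J. A. Williamson, *Random walks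
  and Riesz kernels*, Pacific J. Math. 25 (1968) 393–415, Theorem p. 393 with (1.2) p. 394
  (`lim |x|^d P(|x|) G(0,x) / ∫₀^∞ g_α(v u_x) v^{d-1-α} dv = 1` uniformly in `u_x = x/|x|`, for an
  aperiodic genuinely `d`-dimensional walk attracted to a nondegenerate stable law, window
  `d/2 < α < min(d,2)`, here `3/2 < α < 2`; finiteness of `G` p. 393, Lemma 2-B), the limit being the
  radial integral (3.8) p. 405 of the stable density, i.e. `∫₀^∞ p_t dt` after the substitution
  `p_t(x) = t^{-d/α} g_α(t^{-1/α} x)`; positivity of the limit for `α > 1` p. 406 (Taylor).  For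
  `1 < α ≤ 3/2` the same asymptotic along every ray is Q. Berger, *Strong renewal theorems and local
  large deviations for multivariate random walks and renewals*, Electron. J. Probab. 24 (2019) no. 46,
  Theorem 3.1 (ii) in the balanced case, eq. (3.4) (the pointwise tail above is condition (2.8), which
  implies Assumption 2.2, Appendix B), and the uniformity in the direction follows from Berger's local
  large deviation estimate Theorem 2.6 (uniform in `x`) by Williamson's compactness argument
  (3.3)–(3.9).
* The potential equation: the stable semigroup is Feller with generator given on `C²_c ⊂ C₀^∞`-core
  functions by the Lévy–Khintchine integro-differential formula, O. Kallenberg, *Foundations of Modern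
  Probability* (2nd ed., 2002), Theorem 19.10 eq. (11) (for a symmetric Lévy measure the compensated
  integrand symmetrises to `½ (f(y+z) + f(y-z) - 2f(y))`), and `T_t f - f = ∫₀^t T_s (A f) ds`,
  Theorem 19.6 eq. (4); letting `t → ∞` (transience: `T_t f → 0`, `∫₀^∞ T_s |Af| ds < ∞`) gives
  `∫ K(x-y) Af(y) dy = -f(x)`.

Conventions.  Lattice points are embedded in `EuclideanSpace ℝ (Fin 3)` by
`x ↦ WithLp.toLp 2 (fun i => (x i : ℝ))` (this is `Literature.Probability.LatticeModels.siteVec`,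
not imported to keep this file inside `Probability/Process`); `|x|₂` is its Euclidean norm and
`x/|x|₂ = |x|₂⁻¹ • x`.  `K 0` and `φ` off the unit sphere are junk values (the homogeneity clause
forces `K 0 = 0`).  Consumed by route `CriticalPhenomena/Ising3DConformalLimit/PrecisionLaplacian`
(item `TwoPointSpineGlue`: the critical two-point function as `A₀⁻¹ G_q` for the direct-correlation
step law).

-- TODO(general form): Williamson/Berger allow slowly varying factors (general domains of
-- attraction), asymmetric walks with centring, every `d ≥ 1` with `α < d`, and `0 < α ≤ 1`.

## References
* [Williamson1968] J. A. Williamson, Pacific J. Math. 25 (1968) 393–415, Thm p. 393, (1.2), (3.8).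
* [Berger2019] Q. Berger, Electron. J. Probab. 24 (2019) no. 46, Thm 3.1, Thm 2.6, eq. (2.8), (3.4).
* [Kallenberg2002] O. Kallenberg, Foundations of Modern Probability, 2nd ed., Thm 19.6, Thm 19.10.
-/

noncomputable section

namespace Literature.Probability.Process

open Filter Topology MeasureTheory

/-- NAMED FACT — **Green-function asymptotics of a symmetric random walk on `ℤ³` with an
asymptotically homogeneous tail of index `α ∈ (1,2)`** (Williamson 1968, Theorem p. 393 and (1.2);
Berger 2019, Theorem 3.1 (ii) with Theorem 2.6; potential equation of the limiting stable law:
Kallenberg 2002, Theorems 19.6 and 19.10).  Let `q ≥ 0` be a symmetric probability mass function on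
`ℤ³` with `q(x)|x|₂^{3+α} - φ(x/|x|₂) → 0` cofinitely, `φ` continuous, `≥ 0` and `≢ 0` on the unit
sphere.  Then the walk is transient, `∑_n P(S_n = x) < ∞`, and there is a kernel `K` on `ℝ³`,
continuous and positive off `0`, homogeneous of degree `α - 3`, satisfying the potential equation
`∫ K(x-y) · ½∫ (f(y+z)+f(y-z)-2f(y)) |z|^{-3-α} φ(z/|z|) dz dy = -f(x)` for every `C²` compactly
supported `f` (i.e. `K = ∫₀^∞ p_t dt` is the potential density of the symmetric `α`-stable law with
Lévy measure `φ(z/|z|)|z|^{-3-α}dz`), such that `G_q(x)|x|₂^{3-α} - K(x/|x|₂) → 0` cofinitely.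
[cite: Williamson1968, Theorem p. 393 and eq. (1.2) p. 394, (3.8) p. 405]
[cite: Berger2019, Theorem 3.1 (ii), Theorem 2.6, eq. (2.8) and (3.4)]
[cite: Kallenberg2002, Theorem 19.6 eq. (4) and Theorem 19.10 eq. (11)] -/
def stableWalkGreenAsymptotics : Prop :=
  ∀ (α : ℝ) (q : (Fin 3 → ℤ) → ℝ) (φ : EuclideanSpace ℝ (Fin 3) → ℝ),
    1 < α → α < 2 →
    (∀ x, 0 ≤ q x) → (∀ x, q (-x) = q x) → HasSum q 1 →
    ContinuousOn φ (Metric.sphere 0 1) →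
    (∀ u ∈ Metric.sphere (0 : EuclideanSpace ℝ (Fin 3)) 1, 0 ≤ φ u) →
    (∃ u ∈ Metric.sphere (0 : EuclideanSpace ℝ (Fin 3)) 1, 0 < φ u) →
    Tendsto (fun x : Fin 3 → ℤ =>
        q x * ‖(WithLp.toLp 2 fun i => (x i : ℝ) : EuclideanSpace ℝ (Fin 3))‖ ^ (3 + α) -
          φ (‖(WithLp.toLp 2 fun i => (x i : ℝ) : EuclideanSpace ℝ (Fin 3))‖⁻¹ •
            (WithLp.toLp 2 fun i => (x i : ℝ) : EuclideanSpace ℝ (Fin 3))))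
      cofinite (𝓝 0) →
    (∀ x : Fin 3 → ℤ, Summable fun n : ℕ => jumpChainProb (fun y z => q (z - y)) n 0 x) ∧
    ∃ K : EuclideanSpace ℝ (Fin 3) → ℝ,
      ContinuousOn K {0}ᶜ ∧ (∀ y, y ≠ 0 → 0 < K y) ∧
      (∀ c : ℝ, 0 < c → ∀ y, K (c • y) = c ^ (α - 3) * K y) ∧
      Tendsto (fun x : Fin 3 → ℤ =>
          (∑' n : ℕ, jumpChainProb (fun y z => q (z - y)) n 0 x) *
              ‖(WithLp.toLp 2 fun i => (x i : ℝ) : EuclideanSpace ℝ (Fin 3))‖ ^ (3 - α) -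
            K (‖(WithLp.toLp 2 fun i => (x i : ℝ) : EuclideanSpace ℝ (Fin 3))‖⁻¹ •
              (WithLp.toLp 2 fun i => (x i : ℝ) : EuclideanSpace ℝ (Fin 3))))
        cofinite (𝓝 0) ∧
      ∀ f : EuclideanSpace ℝ (Fin 3) → ℝ, ContDiff ℝ 2 f → HasCompactSupport f →
        ∀ x : EuclideanSpace ℝ (Fin 3),
          (∫ y, K (x - y) * ((1/2 : ℝ) * ∫ z, (f (y + z) + f (y - z) - 2 * f y) *
            (‖z‖ ^ (-(3 + α)) * φ (‖z‖⁻¹ • z)))) = - f x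

end Literature.Probability.Process
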